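import Summits.SmoothPoincare4.SmoothPoincare4.Theorems.ZseSVanishesOnPairs.Negative.MirrorClosure
import Literature.Topology.FourManifolds.Rasmussen
import Literature.Topology.FourManifolds.KnotsIsotopyProofs
import Literature.Topology.FourManifolds.SliceRibbonIsotopyProofs
import Summits.SmoothPoincare4.SmoothPoincare4.Theses.ZeroSurgeryExotic

/-!
# Seeds with a characterising `0`-slope are a vanishing class for `SVanishesOnPairs` (negative lemmas for crux stmt-SmoothPoincare4-0368)

Crux `ZeroSurgeryExotic.ZseSVanishesOnPairs` (item `stmt-SmoothPoincare4-0368`) = the tree's open statement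
`Literature.Uncategorized.SVanishesOnPairs` (on a `0`-surgery pair `(K, K')` with `K` smoothly slice, every
Rasmussen invariant of `K'` is `0`).  Standing disprover, cdisprove gen 4.  A knot `K` is
`0`-CHARACTERISED (in the crux's orientation-blind sense, cf. `MirrorClosure.lean`) when every knot `K'`
sharing a `0`-surgery with it is isotopic to `K` or to its mirror image `K̄`; the hypothesis is spelled out
inline (no definitions in this file).

* `isSmoothlySlice_partner_of_zeroCharacterised` — UNCONDITIONAL: on pairs whose slice member `K` is
  `0`-characterised the partner `K'` is smoothly slice (it is isotopic to the slice knot `K` or `K̄`;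
  sliceness is an isotopy invariant, DISCHARGED `Knot.IsSmoothlySlice.of_isIsotopic_holds`) — the route's
  kill switch `Assembly2` holds on this class, and `zseThesis_seed_not_zeroCharacterised`: no witness of the
  route's THESIS `ZseThesis` is seeded there.
* `sVanishesOnPairs_on_zeroCharacterised` — modulo Rasmussen's theorem ONLY (named fact
  `eq_zero_of_isSmoothlySlice`, applied to the slice partner): on such pairs `s(K') = 0`.
  PRINTED INSTANCES (not constructible in the tree): Baldwin–Sivek, *Zero-surgery characterizes infinitely
  many knots*, Math. Res. Lett. 31 (2024), Thm. 1.1 — `0` is a characterising slope for every pretzel knot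
  `P(-3,3,2n+1)`, `n ∈ ℤ` (all smoothly slice), for `15n43522`, `Wh±(T₂,₃,2)`, and their mirrors; earlier
  `5₂` (Baldwin–Sivek 2022) and `U`, `3₁`, `4₁` (Gabai 1987).  So infinitely many non-trivial slice knots
  can never seed a counterexample: they have no non-trivial `0`-friend at all.
* `zeroCharacterised_mirror` — the class is mirror-closed (unconditional).
* `seed_not_zeroCharacterised_of_not_sVanishesOnPairs` — census form: the slice member of a counterexample
  has a non-characterising `0`-slope and the partner is isotopic neither to it nor to its mirror.
* `zeroCharacterised_unknot_of_propertyR` — Property R in friend form (Gabai 1987, Cor. 8.3) is the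
  degenerate instance `K = U`.
No definitions; no route item is concluded positively.
-/

noncomputable section

set_option linter.dupNamespace false

open scoped Manifold ContDiff
open Literature.Topology.FourManifolds Literature.Uncategorized

namespace Summit.SmoothPoincare4.SmoothPoincare4.Theorems.ZseSVanishesOnPairs.Negative

/-- Isotopy transport of the Rasmussen-invariant predicate, right-to-left form: if `K'` is isotopic to
`K` then every Rasmussen invariant of `K'` is one of `K` (`HasRasmussenInvariant.of_isIsotopic` with the
PROVED symmetry of isotopy). [cite: Rasmussen2010, Thm. 1] -/
theorem hasRasmussenInvariant_of_isIsotopic_right {K K' : Knot} {s : ℤ}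
    (h : K'.HasRasmussenInvariant s) (hi : K'.IsIsotopic K) : K.HasRasmussenInvariant s :=
  h.of_isIsotopic (SphereEmbedding.IsIsotopic.symm_holds hi)

/-- **ON `0`-CHARACTERISED SEEDS THE PARTNER IS SLICE — unconditionally** (the route's kill switch
`Assembly2` restricted to this class): every `0`-friend `K'` of `K` is isotopic to `K` or to `K̄`, both
slice with `K` (`isSmoothlySlice_mirror`), and sliceness is an isotopy invariant (DISCHARGED
`Knot.IsSmoothlySlice.of_isIsotopic_holds`).  Printed instances of the hypothesis: `K = P(-3,3,2n+1)` for
all `n` (Baldwin–Sivek 2024, Thm. 1.1; slice pretzels), `U` (Gabai's Property R).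
[cite: BaldwinSivek2024, Thm. 1.1 (arXiv:2211.04280)] -/
theorem isSmoothlySlice_partner_of_zeroCharacterised {K : Knot}
    (hK : ∀ (K' : Knot) (Y : Type) [TopologicalSpace Y] [ChartedSpace (EuclideanSpace ℝ (Fin 3)) Y],
      IsIntegralSurgery (𝓡 3) Y K 0 → IsIntegralSurgery (𝓡 3) Y K' 0 →
        K'.IsIsotopic K ∨ K'.IsIsotopic K.mirror)
    {K' : Knot} {Y : Type} [TopologicalSpace Y] [ChartedSpace (EuclideanSpace ℝ (Fin 3)) Y]
    (h1 : IsIntegralSurgery (𝓡 3) Y K 0) (h2 : IsIntegralSurgery (𝓡 3) Y K' 0)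
    (h3 : K.IsSmoothlySlice) : K'.IsSmoothlySlice := by
  rcases hK K' Y h1 h2 with hi | hi
  · exact Knot.IsSmoothlySlice.of_isIsotopic_holds (SphereEmbedding.IsIsotopic.symm_holds hi) h3
  · exact Knot.IsSmoothlySlice.of_isIsotopic_holds (SphereEmbedding.IsIsotopic.symm_holds hi)
      (isSmoothlySlice_mirror h3)

/-- **No witness of the route's thesis `ZseThesis` is seeded by a `0`-characterised slice knot**
(unconditional census for the TARGET item stmt-SmoothPoincare4-0364 as well): in any witness
`(K, K', Y)` the slice knot `K` has a non-characterising `0`-slope and `K'` is isotopic neither to `K`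
nor to `K̄`.  Hypothesis = the route decl `ZseThesis`; nothing is concluded positively.
[cite: BaldwinSivek2024, Thm. 1.1 (arXiv:2211.04280)] -/
theorem zseThesis_seed_not_zeroCharacterised
    (h : Summit.SmoothPoincare4.SmoothPoincare4.Theses.ZeroSurgeryExotic.ZseThesis) :
    ∃ (K K' : Knot) (Y : Type) (_ : TopologicalSpace Y) (_ : ChartedSpace (EuclideanSpace ℝ (Fin 3)) Y),
      IsIntegralSurgery (𝓡 3) Y K 0 ∧ IsIntegralSurgery (𝓡 3) Y K' 0 ∧ K.IsSmoothlySlice ∧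
        ¬ K'.IsSmoothlySlice ∧
        (¬ ∀ (K'' : Knot) (Y' : Type) [TopologicalSpace Y'] [ChartedSpace (EuclideanSpace ℝ (Fin 3)) Y'],
            IsIntegralSurgery (𝓡 3) Y' K 0 → IsIntegralSurgery (𝓡 3) Y' K'' 0 →
              K''.IsIsotopic K ∨ K''.IsIsotopic K.mirror) ∧
        ¬ K'.IsIsotopic K ∧ ¬ K'.IsIsotopic K.mirror := by
  obtain ⟨K, K', Y, _, _, h1, h2, h3, h4⟩ := h
  refine ⟨K, K', Y, _, _, h1, h2, h3, h4,
    fun hZ ↦ h4 (isSmoothlySlice_partner_of_zeroCharacterised hZ h1 h2 h3),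
    fun hi ↦ h4 ?_, fun hi ↦ h4 ?_⟩
  · exact Knot.IsSmoothlySlice.of_isIsotopic_holds (SphereEmbedding.IsIsotopic.symm_holds hi) h3
  · exact Knot.IsSmoothlySlice.of_isIsotopic_holds (SphereEmbedding.IsIsotopic.symm_holds hi)
      (isSmoothlySlice_mirror h3)

/-- **`SVanishesOnPairs` HOLDS ON PAIRS WHOSE SLICE MEMBER IS `0`-CHARACTERISED** (modulo Rasmussen's
theorem only).  If every `0`-friend of `K` (tree sense: a common `ℝ³`-charted `0`-surgery `Y`) is isotopic
to `K` or to `K̄`, then for `K` smoothly slice every Rasmussen invariant of every `0`-friend `K'` vanishes: `K'` is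
itself slice (`isSmoothlySlice_partner_of_zeroCharacterised`) and Rasmussen's theorem applies to it.
Printed instances of the hypothesis: `K = P(-3,3,2n+1)` for all `n` (Baldwin–Sivek 2024, Thm. 1.1; these
are slice), `U` (Gabai's Property R). [cite: BaldwinSivek2024, Thm. 1.1 (arXiv:2211.04280)]
[cite: Rasmussen2010, Thm. 1] -/
theorem sVanishesOnPairs_on_zeroCharacterised (hR : eq_zero_of_isSmoothlySlice) {K : Knot}
    (hK : ∀ (K' : Knot) (Y : Type) [TopologicalSpace Y] [ChartedSpace (EuclideanSpace ℝ (Fin 3)) Y],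
      IsIntegralSurgery (𝓡 3) Y K 0 → IsIntegralSurgery (𝓡 3) Y K' 0 →
        K'.IsIsotopic K ∨ K'.IsIsotopic K.mirror)
    {K' : Knot} {Y : Type} [TopologicalSpace Y] [ChartedSpace (EuclideanSpace ℝ (Fin 3)) Y] {s : ℤ}
    (h1 : IsIntegralSurgery (𝓡 3) Y K 0) (h2 : IsIntegralSurgery (𝓡 3) Y K' 0)
    (h3 : K.IsSmoothlySlice) (h4 : K'.HasRasmussenInvariant s) : s = 0 :=
  hR h4 (isSmoothlySlice_partner_of_zeroCharacterised hK h1 h2 h3)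

/-- **The class of `0`-characterised knots is closed under mirror image** — unconditional
(`isIntegralSurgery_zero_mirror_iff`, `K̄̄ = K`), as the orientation-blind pair relation demands.
[folklore] -/
theorem zeroCharacterised_mirror {K : Knot}
    (hK : ∀ (K' : Knot) (Y : Type) [TopologicalSpace Y] [ChartedSpace (EuclideanSpace ℝ (Fin 3)) Y],
      IsIntegralSurgery (𝓡 3) Y K 0 → IsIntegralSurgery (𝓡 3) Y K' 0 →
        K'.IsIsotopic K ∨ K'.IsIsotopic K.mirror) :
    ∀ (K' : Knot) (Y : Type) [TopologicalSpace Y] [ChartedSpace (EuclideanSpace ℝ (Fin 3)) Y],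
      IsIntegralSurgery (𝓡 3) Y K.mirror 0 → IsIntegralSurgery (𝓡 3) Y K' 0 →
        K'.IsIsotopic K.mirror ∨ K'.IsIsotopic K.mirror.mirror := by
  intro K' Y _ _ h1 h2
  rw [show K.mirror.mirror = K from SphereEmbedding.mirror_mirror K]
  exact (hK K' Y ((isIntegralSurgery_zero_mirror_iff K).1 h1) h2).symm

/-- **CENSUS: the slice member of a counterexample to `SVanishesOnPairs` is NOT `0`-characterised, and the
partner is isotopic neither to it nor to its mirror image** (given Rasmussen's theorem).  Printed
exclusions for the seed: `U`, `P(-3,3,2n+1)` (`n ∈ ℤ`). [cite: BaldwinSivek2024, Thm. 1.1 (arXiv:2211.04280)] -/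
theorem seed_not_zeroCharacterised_of_not_sVanishesOnPairs (hR : eq_zero_of_isSmoothlySlice)
    (h : ¬ SVanishesOnPairs) :
    ∃ (K K' : Knot) (Y : Type) (_ : TopologicalSpace Y) (_ : ChartedSpace (EuclideanSpace ℝ (Fin 3)) Y)
      (s : ℤ), IsIntegralSurgery (𝓡 3) Y K 0 ∧ IsIntegralSurgery (𝓡 3) Y K' 0 ∧ K.IsSmoothlySlice ∧
        K'.HasRasmussenInvariant s ∧ s ≠ 0 ∧
        (¬ ∀ (K'' : Knot) (Y' : Type) [TopologicalSpace Y'] [ChartedSpace (EuclideanSpace ℝ (Fin 3)) Y'],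
            IsIntegralSurgery (𝓡 3) Y' K 0 → IsIntegralSurgery (𝓡 3) Y' K'' 0 →
              K''.IsIsotopic K ∨ K''.IsIsotopic K.mirror) ∧
        ¬ K'.IsIsotopic K ∧ ¬ K'.IsIsotopic K.mirror := by
  by_contra hne
  apply h
  intro K K' Y _ _ s h1 h2 h3 h4
  by_contra h5
  refine hne ⟨K, K', Y, _, _, s, h1, h2, h3, h4, h5, fun hZ ↦ h5 ?_, fun hi ↦ h5 ?_, fun hi ↦ h5 ?_⟩
  · exact sVanishesOnPairs_on_zeroCharacterised hR hZ h1 h2 h3 h4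
  · exact hR (hasRasmussenInvariant_of_isIsotopic_right h4 hi) h3
  · exact hR (hasRasmussenInvariant_of_isIsotopic_right h4 hi) (isSmoothlySlice_mirror h3)

/-- **Property R is the degenerate instance**: if every `0`-friend of the unknot is unknotted (Gabai 1987,
Cor. 8.3, in friend form over the crux's own `ℝ³`-charted `Y` — the tree's named fact
`isUnknot_of_isIntegralSurgery_zero` lives on the product model of `S² × S¹`), then the unknot is
`0`-characterised. [cite: GabaiJDG1987, Cor. 8.3] -/
theorem zeroCharacterised_unknot_of_propertyR
    (hPR : ∀ (K' : Knot) (Y : Type) [TopologicalSpace Y] [ChartedSpace (EuclideanSpace ℝ (Fin 3)) Y],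
      IsIntegralSurgery (𝓡 3) Y unknot 0 → IsIntegralSurgery (𝓡 3) Y K' 0 → K'.IsUnknot) :
    ∀ (K' : Knot) (Y : Type) [TopologicalSpace Y] [ChartedSpace (EuclideanSpace ℝ (Fin 3)) Y],
      IsIntegralSurgery (𝓡 3) Y unknot 0 → IsIntegralSurgery (𝓡 3) Y K' 0 →
        K'.IsIsotopic unknot ∨ K'.IsIsotopic unknot.mirror :=
  fun K' Y _ _ h1 h2 ↦ Or.inl (hPR K' Y h1 h2)

end Summit.SmoothPoincare4.SmoothPoincare4.Theorems.ZseSVanishesOnPairs.Negative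

end
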